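import Summits.ABC.IUTFork.Thm311Real2
import Mathlib.RingTheory.PiTensorProduct
import HarnessLib

/-!
# [IUTchIII] Theorem 3.11 over real definitions, G: the ring structure of the real tensor packets and the ACTION of (b)

Record-only file (D-0012) of the abc-iut cell (Cor. 3.12 sub-crew, wave-2 seat abc-iut-c312-5, board row
W2-A); TAKES NO SIDE on [IUTchIII] Cor. 3.12. In `Thm311Real2` the action of the splitting monoids on the tensor
packets (Thm. 3.11 (i) (b), p. 154 l. 10: the splitting monoids are "equipped with a(n) [multiplicative] action" on
`∏_j I^ℚ(…)`) is the BINDER `act` of `MRData.ofShells`. For the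
Dupuy–Hilado-level carriers of `Thm311Real` the packets are rings: [IUTchIII] Prop. 3.1 (i), pp. 92–93 (render p. 93
l. 4–6: the field structures "determine an ind-topological ring structure on `log(^A F_{v_ℚ})`"; locator corrected per
ref-b PASS-B7 B7-2) — here Mathlib's ring structure on the `PiTensorProduct`
of the commutative `ℚ`-algebras `⊕_{v | v_ℚ} K_v` (`Mathlib.RingTheory.PiTensorProduct`: pure tensors multiply
componentwise, `tprod x * tprod y = tprod (x*y)`). With it the (b)-action is DEFINED: `Real.mulAction X … v s` = left
multiplication by `s ∈ ∏_{j} log(^{S^±_{j+1}}D⊢_{v_ℚ})`, componentwise in `j` ([IUTchIII] Prop. 3.4 (ii) p. 102; Thm. 3.11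
(i) (b) p. 154 l. 10 "equipped with a(n) [multiplicative] action"), a `ℚ`-linear endomorphism of
abc-iut-c312-1's `StarPacket v`. No binder. [claim: Mochizuki2012, status: disputed]
typed ≠ discharged; instantiated ≠ endorsed.
-/

noncomputable section

namespace Summit.ABC.IUTFork.Thm311.Real

open NumberField IsDedekindDomain Literature.IUT.LogVolume Literature.IUT.LogThetaLattice
open scoped TensorProduct

variable {F : Type} [Field F] [NumberField F]
variable (X : PilotData F) (logv : PadicLogs F) (Aut Ism : ∀ x : Place F, Set (Carrier x ≃ₗ[ℚ] Carrier x))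
  (hAut : ∀ x, LinearEquiv.refl ℚ (Carrier x) ∈ Aut x) (hIsm : ∀ x, LinearEquiv.refl ℚ (Carrier x) ∈ Ism x)

/-- The 1-packet `⊕_{v | v_ℚ} K_v` of the real carriers is a commutative ring (product of fields; [IUTchIII] Prop.
3.1 (i), pp. 92–93: "direct sum" of topological fields). [folklore] -/
instance packet1CommRing (vQ : RatPlace) : CommRing ((logShells X logv Aut Ism hAut hIsm).Packet1 vQ) :=
  inferInstanceAs (CommRing (∀ w : (thetaIndex X).Fibre vQ, Carrier w.1))

/-- … and a `ℚ`-algebra. [folklore] -/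
instance packet1Algebra (vQ : RatPlace) : Algebra ℚ ((logShells X logv Aut Ism hAut hIsm).Packet1 vQ) :=
  inferInstanceAs (Algebra ℚ (∀ w : (thetaIndex X).Fibre vQ, Carrier w.1))

/-- **The ring structure on the `(j+1)`-tensor packet** `log(^{S^±_{j+1}}D⊢_{v_ℚ}) = ⊗_{i} ⊕_{v|v_ℚ} K_v`
([IUTchIII] Prop. 3.1 (i), pp. 92–93), Mathlib's `PiTensorProduct.instCommRing`. [claim: Mochizuki2012, status: disputed] -/
instance packetCommRing (j : (thetaIndex X).Label) (vQ : RatPlace) :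
    CommRing ((logShells X logv Aut Ism hAut hIsm).Packet j vQ) :=
  inferInstanceAs (CommRing (⨂[ℚ] _i : (thetaIndex X).Caps j, (∀ w : (thetaIndex X).Fibre vQ, Carrier w.1)))

/-- Pure tensors multiply componentwise in the packet ring (`PiTensorProduct.tprod_mul_tprod`). [folklore] -/
theorem tprod_mul_tprod (j : (thetaIndex X).Label) (vQ : RatPlace)
    (x y : (thetaIndex X).Caps j → (logShells X logv Aut Ism hAut hIsm).Packet1 vQ) :
    (logShells X logv Aut Ism hAut hIsm).tprod j vQ x * (logShells X logv Aut Ism hAut hIsm).tprod j vQ y =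
      (logShells X logv Aut Ism hAut hIsm).tprod j vQ (x * y) :=
  PiTensorProduct.tprod_mul_tprod x y

/-- **The (b)-ACTION, DEFINED**: an element `s = (s_j)_j ∈ ∏_{j ∈ F_l^⋇} log(^{S^±_{j+1}}D⊢_{v_ℚ})` (e.g. an element
of the splitting monoid `Real.splittingMonoidLGP`, `Thm311RealTate`) acts on `∏_j log(^{S^±_{j+1}}D⊢_{v_ℚ})` by
componentwise LEFT MULTIPLICATION in the packet rings ([IUTchIII] Prop. 3.4 (ii) p. 102; Thm. 3.11 (i) (b) p. 154
l. 10: "equipped with a(n) [multiplicative] action") — a `ℚ`-linear endomorphism, i.e. an inhabitant of the type of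
the binder `act v hv s` of `MRData.ofShells`. [claim: Mochizuki2012, status: disputed] -/
def mulAction (v : Place F) (s : (logShells X logv Aut Ism hAut hIsm).StarPacket v) :
    Module.End ℚ ((logShells X logv Aut Ism hAut hIsm).StarPacket v) where
  toFun f := fun j => s j * f j
  map_add' f g := by
    funext j
    exact mul_add (s j) (f j) (g j)
  map_smul' c f := by
    funext j
    exact mul_smul_comm c (s j) (f j)

/-- The action is componentwise multiplication. [folklore] -/
theorem mulAction_apply (v : Place F) (s f : (logShells X logv Aut Ism hAut hIsm).StarPacket v)
    (j : (thetaIndex X).LabelStar) : mulAction X logv Aut Ism hAut hIsm v s f j = s j * f j := rfl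

/-- The action is multiplicative in `s` (a monoid action of `∏_j log(…)` on itself). [folklore] -/
theorem mulAction_mul (v : Place F) (s t : (logShells X logv Aut Ism hAut hIsm).StarPacket v) :
    mulAction X logv Aut Ism hAut hIsm v (s * t) =
      mulAction X logv Aut Ism hAut hIsm v s * mulAction X logv Aut Ism hAut hIsm v t := by
  ext f j
  show (s j * t j) * f j = s j * (t j * f j)
  exact mul_assoc _ _ _

/-- The unit acts trivially. [folklore] -/
theorem mulAction_one (v : Place F) : mulAction X logv Aut Ism hAut hIsm v 1 = 1 := by
  ext f j
  show 1 * f j = f j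
  exact one_mul _

/-! ## The sub-packets are ideals: the (b)-action preserves `∏_j log(^{S^±_{j+1},j}D⊢_v)` (appended; theorems only)

[IUTchIII] Prop. 3.1 (ii) / 3.2: `log(^{A,α}D⊢_v)` is "the tensor product of the factors labeled by `β ≠ α` with
the direct summand with subscript `v` of the factor labeled `α`" — a direct-summand IDEAL of the packet ring; so
multiplication by ANY packet element, in particular the (b)-action `Real.mulAction` of a splitting-monoid element,
maps abc-iut-c312-1's `SubPacket j v` into itself ([IUTchIII] Prop. 3.4 (ii): the splitting monoid acts on
`I^ℚ(^{S^±_{j+1},j};F_v)`). -/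

/-- A pure tensor times an element of the sub-packet `log(^{S^±_{j+1},j}D⊢_v)` stays in the sub-packet (the
support condition on the factor `j` is preserved by componentwise multiplication). [claim: Mochizuki2012, status: disputed] -/
theorem tprod_mul_mem_subPacket (j : (thetaIndex X).Label) (v : (thetaIndex X).V)
    (a : (thetaIndex X).Caps j → (logShells X logv Aut Ism hAut hIsm).Packet1 ((thetaIndex X).over v))
    {y : (logShells X logv Aut Ism hAut hIsm).Packet j ((thetaIndex X).over v)}
    (hy : y ∈ (logShells X logv Aut Ism hAut hIsm).SubPacket j v) :
    (logShells X logv Aut Ism hAut hIsm).tprod j _ a * y ∈ (logShells X logv Aut Ism hAut hIsm).SubPacket j v := by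
  letI : Algebra ℚ ((logShells X logv Aut Ism hAut hIsm).Packet j ((thetaIndex X).over v)) :=
    inferInstanceAs (Algebra ℚ (⨂[ℚ] _i : (thetaIndex X).Caps j,
      (∀ w : (thetaIndex X).Fibre ((thetaIndex X).over v), Carrier w.1)))
  induction hy using Submodule.span_induction with
  | mem y hy =>
    obtain ⟨z, hz, rfl⟩ := hy
    rw [tprod_mul_tprod]
    refine Submodule.subset_span ⟨a * z, fun w hw => ?_, rfl⟩
    show @HMul.hMul (Carrier w.1) (Carrier w.1) (Carrier w.1) instHMul
        (a ((thetaIndex X).selfIndex j) w) (z ((thetaIndex X).selfIndex j) w) = 0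
    rw [hz w hw]
    exact mul_zero _
  | zero => rw [mul_zero]; exact Submodule.zero_mem _
  | add x y _ _ hx hy => rw [mul_add]; exact Submodule.add_mem _ hx hy
  | smul c x _ hx => rw [mul_smul_comm]; exact Submodule.smul_mem _ c hx

/-- **The sub-packet `log(^{S^±_{j+1},j}D⊢_v)` is an ideal of the packet ring**: `s · y ∈ SubPacket j v` for every
packet element `s` and `y ∈ SubPacket j v`. [claim: Mochizuki2012, status: disputed] -/
theorem mul_mem_subPacket (j : (thetaIndex X).Label) (v : (thetaIndex X).V)
    (s : (logShells X logv Aut Ism hAut hIsm).Packet j ((thetaIndex X).over v))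
    {y : (logShells X logv Aut Ism hAut hIsm).Packet j ((thetaIndex X).over v)}
    (hy : y ∈ (logShells X logv Aut Ism hAut hIsm).SubPacket j v) :
    s * y ∈ (logShells X logv Aut Ism hAut hIsm).SubPacket j v := by
  letI : Algebra ℚ ((logShells X logv Aut Ism hAut hIsm).Packet j ((thetaIndex X).over v)) :=
    inferInstanceAs (Algebra ℚ (⨂[ℚ] _i : (thetaIndex X).Caps j,
      (∀ w : (thetaIndex X).Fibre ((thetaIndex X).over v), Carrier w.1)))
  induction s using PiTensorProduct.induction_on with
  | smul_tprod r a =>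
    convert Submodule.smul_mem _ r (tprod_mul_mem_subPacket X logv Aut Ism hAut hIsm j v a hy) using 1
    exact smul_mul_assoc r _ y
  | add x x' hx hx' =>
    convert Submodule.add_mem _ hx hx' using 1
    exact add_mul x x' y

/-- **The (b)-ACTION PRESERVES `∏_{j} log(^{S^±_{j+1},j}D⊢_v)`** ([IUTchIII] Prop. 3.4 (ii): the splitting monoid acts
on `I^ℚ(^{S^±_{j+1},j};F_v)`): `Real.mulAction v s` maps families lying componentwise in the sub-packets to such
families — for every `s`, in particular for `s` in the LGP splitting monoid. [claim: Mochizuki2012, status: disputed] -/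
theorem mulAction_mem_subPackets (v : (thetaIndex X).V) (s f : (logShells X logv Aut Ism hAut hIsm).StarPacket v)
    (hf : ∀ j : (thetaIndex X).LabelStar, f j ∈ (logShells X logv Aut Ism hAut hIsm).SubPacket j.1 v)
    (j : (thetaIndex X).LabelStar) :
    mulAction X logv Aut Ism hAut hIsm v s f j ∈ (logShells X logv Aut Ism hAut hIsm).SubPacket j.1 v :=
  mul_mem_subPacket X logv Aut Ism hAut hIsm j.1 v (s j) (hf j)

end Summit.ABC.IUTFork.Thm311.Real

end
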